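import Literature.NumberTheory.EllipticCurves.AnticyclotomicBigGaloisRep
import Literature.NumberTheory.GaloisRepresentations.ContinuousCohomologyConnecting
import HarnessLib

/-!
# Crux 4 `BSDpOnCellC` (stmt-BirchSwinnertonDyer-19034), line «telescope», leaf N2 sub-leaf W3 / leaf N3′ — THE BIG-MODULE MAP INDUCED BY A
# MORPHISM OF COEFFICIENTS WITH BOUNDED-TORSION KERNEL AND COKERNEL (successor LEAD `cruxlead-19034` g3; `--supports`, helper; THEOREMS ONLY)

HONEST FRAMING. Generic; no curve; proves no stub, no crux, no summit statement; BSD is proved for no curve. Companion of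
`…TelescopeK2CohomologyTransfer` (the `H¹` / Selmer / dual transport along a morphism `f` of discrete `Γ`-modules with
(hker) `f m = 0 → a • m = 0` and (hcoker) `∀ m₂, ∃ m₁, f m₁ = b • m₂`). THIS file manufactures such an `f` for the big (co-induced)
modules `A ⊗ Λ^*` of the telescope (`BigRepModule 𝒪 p A`, `bigRep κ ρ`): an `𝒪`-linear `G`-equivariant `θ : A₁ → A₂` of discrete
coefficient modules whose kernel is killed by `c₁ ∈ 𝒪` and whose cokernel is killed by `c₂ ∈ 𝒪` (for the fibre data (fd₀)/(fd_k) of leaf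
N1: FINITE kernel and cokernel, `cᵢ = p^{eᵢ}`) induces `θ_* = mapRangeₗ θ : A₁ ⊗ Λ^* → A₂ ⊗ Λ^*`, a morphism of the big representations
over `Λ_𝒪 = 𝒪⟦T⟧` (tree `BigRepModule.mapRangeₗ`, `mapRange_bigRep`), and:

* `C_smul_eq_zero_of_mapRange_eq_zero` — (hker) for `θ_*` with `a = C c₁`: a smooth function killed by `θ_*` is valued in `ker θ`;
* `exists_mapRange_eq_C_smul` — (hcoker) for `θ_*` with `b = C c₂` when `A₁` is `p`-primary: lift `Φ₂` along a set-theoretic section `s`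
  of `θ` over `c₂ • A₂`; `s ∘ Φ₂` is smooth of the same level and `p`-primary because it takes finitely many values
  (`x ↦ x.appr n`, as in x2-p2 g19's `TelescopeK2GlobalDefectFinite.exists_C_pow_smul_eq_zero`);
* `exists_hom_bigRep_of_coefficients` — the package: a morphism `f : (bigRep κ ρ₁).toTopRep ⟶ (bigRep κ ρ₂).toTopRep` with
  `f Φ x = θ (Φ x)`, (hker) with `a = C c₁` and (hcoker) with `b = C c₂` — exactly the hypotheses of
  `TelescopeK2CohomologyTransfer.exists_dual_selmer_transfer` / `exists_mem_selmer_cohomologyMap_eq_smul`.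

References: F. Castella, Camb. J. Math. 6 (2018) §2.1 and Erratum §2 (the modules `T ⊗ Λ^*`, `M_g`) [Castella2018] [Castella2018Erratum];
C. Skinner–E. Urban, Invent. Math. 195 (2014) §3.1.3, Prop. 3.2.3 (co-induced model) [SkinnerUrban2014]; R. Greenberg, LNM 1716 (1999) §4
(bounded kernels/cokernels) [GreenbergLNM1716].
-/

noncomputable section

open CategoryTheory Literature.NumberTheory.GaloisRepresentations Literature.NumberTheory.EllipticCurves
  Literature.NumberTheory.EllipticCurves.BigRepModule

set_option linter.dupNamespace false

universe u

namespace Summit.BirchSwinnertonDyer.BirchSwinnertonDyer.Theorems.TelescopeK2BigRepTransfer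

variable {𝒪 : Type*} [CommRing 𝒪] {p : ℕ} [Fact p.Prime]
  {A₁ : Type u} [AddCommGroup A₁] [Module 𝒪 A₁] {A₂ : Type u} [AddCommGroup A₂] [Module 𝒪 A₂]

/-! ## §1 Kernel: `θ_* Φ = 0 → (C c₁) • Φ = 0` -/

/-- **(hker) for `θ_*`.** If `ker θ` is killed by `c₁` then `ker θ_*` is killed by `C c₁ ∈ 𝒪⟦T⟧`: a smooth function `Φ` with `θ ∘ Φ = 0` is
valued in `ker θ`, so `c₁ • Φ = 0` pointwise. [cite: GreenbergLNM1716, §4] -/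
theorem C_smul_eq_zero_of_mapRange_eq_zero (θ : A₁ →ₗ[𝒪] A₂) {c₁ : 𝒪} (hker : ∀ a : A₁, θ a = 0 → c₁ • a = 0)
    {Φ : BigRepModule 𝒪 p A₁} (hΦ : mapRange θ Φ = 0) : (PowerSeries.C c₁ : PowerSeries 𝒪) • Φ = 0 := by
  rw [C_smul]
  ext x
  rw [BigRepModule.smul_apply, BigRepModule.zero_apply]
  exact hker _ (by rw [← mapRange_apply (p := p) θ Φ x, hΦ, BigRepModule.zero_apply])

/-! ## §2 Cokernel: `∀ Φ₂, ∃ Φ₁, θ_* Φ₁ = (C c₂) • Φ₂` (for `p`-primary `A₁`) -/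

/-- A set-theoretic section of `θ` over `c₂ • A₂`. [folklore] -/
theorem exists_section (θ : A₁ →ₗ[𝒪] A₂) {c₂ : 𝒪} (hcoker : ∀ a₂ : A₂, ∃ a₁ : A₁, θ a₁ = c₂ • a₂) :
    ∃ s : A₂ → A₁, ∀ a₂, θ (s a₂) = c₂ • a₂ :=
  ⟨fun a₂ => (hcoker a₂).choose, fun a₂ => (hcoker a₂).choose_spec⟩

/-- **The lift `s ∘ Φ₂` is a smooth `p`-primary function** when `A₁` is `p`-primary: it has the level of `Φ₂`, and it takes finitely many
values (read off at `x.appr n < p^n`), each killed by a power of `p`. [cite: SkinnerUrban2014, §3.1.3 and proof of Prop. 3.2.3] -/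
theorem comp_mem_bigRepSubmodule (hA₁ : ∀ a : A₁, ∃ k : ℕ, p ^ k • a = 0) (s : A₂ → A₁) (Φ₂ : BigRepModule 𝒪 p A₂) :
    (fun x => s (Φ₂ x)) ∈ bigRepSubmodule 𝒪 p A₁ := by
  classical
  obtain ⟨n, hn⟩ := Φ₂.exists_level
  refine ⟨⟨n, fun x y hxy => congrArg s (hn x y hxy)⟩, ?_⟩
  choose kA hkA using hA₁
  refine ⟨(Finset.range (p ^ n)).sup fun i : ℕ => kA (s (Φ₂ (i : ℤ_[p]))), fun x => ?_⟩
  have hx : Φ₂ x = Φ₂ ((x.appr n : ℕ) : ℤ_[p]) := hn _ _ (PadicInt.appr_spec n x)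
  have hi : x.appr n ∈ Finset.range (p ^ n) := Finset.mem_range.mpr (PadicInt.appr_lt x n)
  obtain ⟨d, hd⟩ := Nat.exists_eq_add_of_le
    (Finset.le_sup (f := fun i : ℕ => kA (s (Φ₂ (i : ℤ_[p])))) hi)
  change p ^ _ • s (Φ₂ x) = 0
  rw [hx, hd, pow_add, mul_comm, mul_smul, hkA, smul_zero]

/-- **(hcoker) for `θ_*`.** If `coker θ` is killed by `c₂` (`c₂ • A₂ ⊆ im θ`) and `A₁` is `p`-primary then `coker θ_*` is killed by
`C c₂ ∈ 𝒪⟦T⟧`: `θ_* (s ∘ Φ₂) = c₂ • Φ₂`. [cite: GreenbergLNM1716, §4] [cite: SkinnerUrban2014, proof of Prop. 3.2.3] -/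
theorem exists_mapRange_eq_C_smul (θ : A₁ →ₗ[𝒪] A₂) {c₂ : 𝒪} (hcoker : ∀ a₂ : A₂, ∃ a₁ : A₁, θ a₁ = c₂ • a₂)
    (hA₁ : ∀ a : A₁, ∃ k : ℕ, p ^ k • a = 0) (Φ₂ : BigRepModule 𝒪 p A₂) :
    ∃ Φ₁ : BigRepModule 𝒪 p A₁, mapRange θ Φ₁ = (PowerSeries.C c₂ : PowerSeries 𝒪) • Φ₂ := by
  obtain ⟨s, hs⟩ := exists_section θ hcoker
  refine ⟨BigRepModule.mk _ (comp_mem_bigRepSubmodule hA₁ s Φ₂), ?_⟩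
  rw [C_smul]
  ext x
  rw [mapRange_apply, mk_apply, hs, BigRepModule.smul_apply]

/-! ## §3 The package: a morphism of big representations with (hker)/(hcoker) -/

variable [TopologicalSpace 𝒪] [TopologicalSpace A₁] [DiscreteTopology A₁] [TopologicalSpace A₂] [DiscreteTopology A₂]
  {G : Type u} [Group G] [TopologicalSpace G] [ContinuousMul G] [TopologicalSpace (PowerSeries 𝒪)]
  [ContinuousSMul (PowerSeries 𝒪) (BigRepModule 𝒪 p A₁)] [ContinuousSMul (PowerSeries 𝒪) (BigRepModule 𝒪 p A₂)]

/-- **The morphism of big representations induced by an equivariant morphism of coefficients, with its kernel/cokernel bounds.** For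
`κ : G →ₜ* ℤ_p`, discrete `ρᵢ : ContinuousRep G 𝒪 Aᵢ` and an `𝒪`-linear `θ : A₁ → A₂` intertwining `ρ₁`, `ρ₂`, whose kernel is killed by
`c₁` and whose cokernel is killed by `c₂`, with `A₁` `p`-primary: there is a morphism `f : (bigRep κ ρ₁) ⟶ (bigRep κ ρ₂)` of the attached
topological representations over `𝒪⟦T⟧` with `f Φ x = θ (Φ x)` (it is `mapRangeₗ θ`), (hker) `f Φ = 0 → (C c₁) • Φ = 0` and (hcoker)
`∀ Φ₂, ∃ Φ₁, f Φ₁ = (C c₂) • Φ₂` — the hypotheses of `TelescopeK2CohomologyTransfer.exists_dual_selmer_transfer` with `a = C c₁`, `b = C c₂`.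
For the anticyclotomic specialisation take `G = Γ_K`, `κ := (κ : ZpExtension K p).toContinuousMonoidHom` (`AnticyclotomicBigGaloisRep` is
`bigRep` of it by `rfl`). [cite: Castella2018Erratum, §2 p. 4 ((b) transported to M_g)] [cite: GreenbergLNM1716, §4] -/
theorem exists_hom_bigRep_of_coefficients (κ : G →ₜ* Multiplicative ℤ_[p]) (ρ₁ : ContinuousRep G 𝒪 A₁)
    (ρ₂ : ContinuousRep G 𝒪 A₂) (θ : A₁ →ₗ[𝒪] A₂) (hθ : ∀ (g : G) (a : A₁), θ (ρ₁ g a) = ρ₂ g (θ a))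
    {c₁ c₂ : 𝒪} (hker : ∀ a : A₁, θ a = 0 → c₁ • a = 0) (hcoker : ∀ a₂ : A₂, ∃ a₁ : A₁, θ a₁ = c₂ • a₂)
    (hA₁ : ∀ a : A₁, ∃ k : ℕ, p ^ k • a = 0) :
    ∃ f : (bigRep (p := p) κ ρ₁).toTopRep ⟶ (bigRep (p := p) κ ρ₂).toTopRep,
      (∀ (Φ : BigRepModule 𝒪 p A₁) (x : ℤ_[p]), f.hom Φ x = θ (Φ x)) ∧
      (∀ Φ : BigRepModule 𝒪 p A₁, f.hom Φ = 0 → (PowerSeries.C c₁ : PowerSeries 𝒪) • Φ = 0) ∧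
      (∀ Φ₂ : BigRepModule 𝒪 p A₂, ∃ Φ₁ : BigRepModule 𝒪 p A₁, f.hom Φ₁ = (PowerSeries.C c₂ : PowerSeries 𝒪) • Φ₂) := by
  let f : (bigRep (p := p) κ ρ₁).toTopRep ⟶ (bigRep (p := p) κ ρ₂).toTopRep :=
    TopRep.ofHom ⟨⟨mapRangeₗ θ, continuous_of_discreteTopology⟩, fun g => by
      ext Φ x
      exact DFunLike.congr_fun (mapRange_bigRep κ ρ₁ ρ₂ θ hθ g Φ) x⟩
  have hf : ∀ Φ : BigRepModule 𝒪 p A₁, f.hom Φ = mapRange θ Φ := fun Φ => rfl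
  refine ⟨f, fun Φ x => rfl, fun Φ hΦ => ?_, fun Φ₂ => ?_⟩
  · exact C_smul_eq_zero_of_mapRange_eq_zero θ hker (by rw [← hf]; exact hΦ)
  · obtain ⟨Φ₁, hΦ₁⟩ := exists_mapRange_eq_C_smul θ hcoker hA₁ Φ₂
    exact ⟨Φ₁, by rw [hf, hΦ₁]⟩

end Summit.BirchSwinnertonDyer.BirchSwinnertonDyer.Theorems.TelescopeK2BigRepTransfer

end
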